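import Mathlib
import Summits.AtomisticToContinuum.HydrodynamicLimit.Theorems.ImplosionDichotomyDenseExcursionProjectiveCovariance
import Summits.AtomisticToContinuum.HydrodynamicLimit.Theorems.ImplosionDichotomyDenseExcursionR2Modes

/-!
# Self-similar variables of the hard-sphere Euler system (line `r2-one-mode-two-conditions`, skeleton v5 §0b)

Crux `Summit.AtomisticToContinuum.HydrodynamicLimit.Theses.ImplosionDichotomy.DenseExcursion`
(stmt-AtomisticToContinuum-12586), line `r2-one-mode-two-conditions`, registered skeleton
`Cruxes/DenseExcursion/Lines/r2_one_mode_two_conditions.lean` (v5, parallel lead c1-0). This module carries the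
line-posited DEFINITIONS of §0b verbatim — the dynamical self-similar change of variables typed at the same pointwise
`fderiv` level as the sibling line's landed `EulerZAt` / `ProjectiveCovariance` (`Theorems.KidderKnobMelnikov`,
p72839) — so that the three registered calculus stubs `stub_selfSimilarCovariance` (W1), `stub_radialReduction` (W4),
`stub_isentropicReduction` (W2) can be proved in separate files importing ONE copy, and it proves the registered stub
`stub_linearisation`: the planner's hand-posited linearised operator `(linW, linS)` of the r2 spectral vocabulary
(`IsSmoothRadialMode`, `OneModeTwoConditions`) IS the linearisation of the isentropic self-similar system of
`IsentropicReduction`.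

Conventions (derived by hand in this seat and cross-checked against the landed original-form profile equations of
`stub_profileEqs`): time-to-collapse `s = T e^{-rτ}`, `t = T - s`, `x = x₀ + s^{1/r} ζ`; `ρ = s^{-(3-3/r)} 𝒫`,
`u = r⁻¹ s^{1/r-1} 𝒱`, `θ = r⁻² s^{2/r-2} Θ̂`; every power `s^a` is written `T^a e^{-raτ}` so that only `Real.exp`
is ever differentiated. The physical system `EulerZAt σ h Z` at `(t, x)` is, up to the positive factors
`r s^{4-3/r}`, `r² s^{5-4/r}`, `r³ s^{3-2/r}`, the SELF-SIMILAR system `SelfSimEulerZAt r D H Z` at `(τ, ζ)` with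
the exponentially GROWING diameter `D(τ) = σ s^{1/r-1}` (packing `𝒫 D³ = ρ σ³` is invariant) and heating
`H(τ) = r s h(t)`: `∂_τ𝒫 + ∇·(𝒫(𝒱 + ζ)) + (3r-6)𝒫 = 0`,
`𝒫(∂_τ𝒱 + (r-1)𝒱 + ((ζ+𝒱)·∇)𝒱) + ∇(𝒫 Θ̂ Z(𝒫D³)) = 0`,
`∂_τΘ̂ + 2(r-1)Θ̂ + (ζ+𝒱)·∇Θ̂ + (2/3)Θ̂ Z ∇·𝒱 = H Θ̂ (Z-1)`. Radial fields `𝒫 = pf(τ, log‖ζ‖)`,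
`𝒱 = -w(τ, log‖ζ‖) ζ`, `Θ̂ = ‖ζ‖² tf(τ, log‖ζ‖)` reduce it to three scalar equations in `(pf, w, tf)(τ, x)`
(`RadialReduction`), and the isentropic ideal ansatz `𝒫 = C‖ζ‖³sf³`, `Θ̂ = (3/5)‖ζ‖²sf²` to
`w_τ = (w-1)w' + 3 sf sf' + w² - rw + 3 sf²`, `sf_τ = (w-1)sf' + (sf/3)w' + sf(2w-r)` (`IsentropicReduction`), whose
steady states are exactly the landed original-form profile equations and whose linearisation is `(linW, linS)`
(`stub_linearisation`, proved here). Sources: Merle–Raphaël–Rodnianski–Szeftel 2022 §2, Biasi 2021 §2 (Emden /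
self-similar variables), Buckmaster–Cao-Labora–Gómez-Serrano 2025 §1.3; all statements here are folklore calculus.
-/

noncomputable section

open Filter Set
open scoped Topology ContDiff

namespace Summit.AtomisticToContinuum.HydrodynamicLimit.Theorems.R2OneModeTwoConditions

open Literature.MathematicalPhysics.KineticTheory (V3)


open Summit.AtomisticToContinuum.HydrodynamicLimit.Theorems.KidderKnobMelnikov (dT dX EulerZAt)

/-- The self-similar point map `(τ, ζ) ↦ (t, x) = (T - T e^{-rτ}, x₀ + T^{1/r} e^{-τ} ζ)`. -/
def ssMap (T r : ℝ) (x₀ : V3) (z : ℝ × V3) : ℝ × V3 :=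
  (T - T * Real.exp (-(r * z.1)), x₀ + (T ^ (1 / r) * Real.exp (-z.1)) • z.2)

/-- Self-similar density `𝒫(τ, ζ) = s^{3-3/r} ρ(t, x)`, `s = T e^{-rτ}`. -/
def ssDensity (T r : ℝ) (x₀ : V3) (P : ℝ × V3 → ℝ) (z : ℝ × V3) : ℝ :=
  (T ^ (3 - 3 / r) * Real.exp (-((3 * r - 3) * z.1))) * P (ssMap T r x₀ z)

/-- Self-similar velocity `𝒱(τ, ζ) = r s^{1-1/r} u(t, x)`. -/
def ssVelocity (T r : ℝ) (x₀ : V3) (U : ℝ × V3 → V3) (z : ℝ × V3) : V3 :=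
  (r * (T ^ (1 - 1 / r) * Real.exp (-((r - 1) * z.1)))) • U (ssMap T r x₀ z)

/-- Self-similar temperature `Θ̂(τ, ζ) = r² s^{2-2/r} θ(t, x)`. -/
def ssTemperature (T r : ℝ) (x₀ : V3) (Θ : ℝ × V3 → ℝ) (z : ℝ × V3) : ℝ :=
  (r ^ 2 * (T ^ (2 - 2 / r) * Real.exp (-((2 * r - 2) * z.1)))) * Θ (ssMap T r x₀ z)

/-- The SELF-SIMILAR full Euler system of a monatomic gas with equation of state `Z`, (growing) diameter `D(τ)`
and heating rate `H(τ) Θ̂ (Z-1)`, blow-up speed `r`, at `z = (τ, ζ) ∈ ℝ × ℝ³` (non-conservative form; see the block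
docstring for the three equations). -/
def SelfSimEulerZAt (r : ℝ) (D H : ℝ → ℝ) (Z : ℝ → ℝ) (Ps Θ : ℝ × V3 → ℝ) (Vs : ℝ × V3 → V3)
    (z : ℝ × V3) : Prop :=
  dT Ps z + ∑ i, dX i (fun w => Ps w * (Vs w i + w.2 i)) z + (3 * r - 6) * Ps z = 0 ∧
  (∀ j : Fin 3, Ps z * (dT (fun w => Vs w j) z + (r - 1) * Vs z j +
        ∑ i, (z.2 i + Vs z i) * dX i (fun w => Vs w j) z) +
      dX j (fun w => Ps w * Θ w * Z (Ps w * D w.1 ^ 3)) z = 0) ∧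
  dT Θ z + 2 * (r - 1) * Θ z + ∑ i, (z.2 i + Vs z i) * dX i Θ z +
      (2 / 3) * Θ z * Z (Ps z * D z.1 ^ 3) * ∑ i, dX i (fun w => Vs w i) z =
    H z.1 * Θ z * (Z (Ps z * D z.1 ^ 3) - 1)

/-- Statement of `stub_selfSimilarCovariance` (W1): for `T, r > 0`, every centre `x₀`, diameter `σ`, heating `h`,
equation of state `Z` differentiable at the (invariant) packing, and fields differentiable at the physical point, the
physical system `EulerZAt σ h Z` holds at `(t, x) = ssMap T r x₀ (τ, ζ)` iff the self-similar system with diameter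
`D(τ) = σ (T e^{-rτ})^{1/r-1}` (written `σ T^{1/r-1} e^{(r-1)τ}`) and heating `H(τ) = r T e^{-rτ} h(t)` holds at
`(τ, ζ)` for the self-similar fields. Chain rule on `ℝ × ℝ³` (template: `Theorems.KidderKnobMelnikov.dual_mass /
dual_momentum / dual_temperature`); the residuals scale by `r s^{4-3/r}`, `r² s^{5-4/r}`, `r³ s^{3-2/r}`. -/
def SelfSimilarCovariance : Prop :=
  ∀ (T r σ : ℝ), 0 < T → 0 < r → ∀ (x₀ : V3) (h Z : ℝ → ℝ) (P Θ : ℝ × V3 → ℝ) (U : ℝ × V3 → V3)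
    (z : ℝ × V3),
    DifferentiableAt ℝ P (ssMap T r x₀ z) → DifferentiableAt ℝ Θ (ssMap T r x₀ z) →
    DifferentiableAt ℝ U (ssMap T r x₀ z) → DifferentiableAt ℝ Z (P (ssMap T r x₀ z) * σ ^ 3) →
    (EulerZAt (fun _ => σ) h Z P Θ U (ssMap T r x₀ z) ↔
      SelfSimEulerZAt r (fun τ => σ * (T ^ (1 / r - 1) * Real.exp ((r - 1) * τ)))
        (fun τ => r * (T * Real.exp (-(r * τ))) * h (T - T * Real.exp (-(r * τ)))) Z
        (ssDensity T r x₀ P) (ssTemperature T r x₀ Θ) (ssVelocity T r x₀ U) z)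

/-- `∂_τ f` of a scalar function of `(τ, x) ∈ ℝ × ℝ`. -/
def dτ (f : ℝ × ℝ → ℝ) (p : ℝ × ℝ) : ℝ := fderiv ℝ f p ((1 : ℝ), (0 : ℝ))

/-- `∂_x f` of a scalar function of `(τ, x) ∈ ℝ × ℝ`. -/
def dx (f : ℝ × ℝ → ℝ) (p : ℝ × ℝ) : ℝ := fderiv ℝ f p ((0 : ℝ), (1 : ℝ))

/-- The radial point `(τ, log ‖ζ‖)` seen from `z = (τ, ζ)`. -/
def logPt (z : ℝ × V3) : ℝ × ℝ := (z.1, Real.log ‖z.2‖)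

/-- Radial self-similar density `𝒫(τ, ζ) = pf(τ, log ‖ζ‖)`. -/
def radDensity (pf : ℝ × ℝ → ℝ) (z : ℝ × V3) : ℝ := pf (logPt z)

/-- Radial self-similar velocity `𝒱(τ, ζ) = -w(τ, log ‖ζ‖) ζ` (`w > 0` is inflow; profile: `w = W`). -/
def radVelocity (w : ℝ × ℝ → ℝ) (z : ℝ × V3) : V3 := (-w (logPt z)) • z.2

/-- Radial self-similar temperature `Θ̂(τ, ζ) = ‖ζ‖² tf(τ, log ‖ζ‖)` (profile: `tf = (3/5) S²`). -/
def radTemperature (tf : ℝ × ℝ → ℝ) (z : ℝ × V3) : ℝ := ‖z.2‖ ^ 2 * tf (logPt z)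

/-- Statement of `stub_radialReduction` (W4): off the centre (`ζ ≠ 0`), for radial fields built from
`(pf, w, tf)(τ, x)` differentiable at `p = (τ, log‖ζ‖)` with `pf(p) > 0` and `Z` differentiable at the packing
`pf(p) D(τ)³`, the self-similar system is equivalent to the three scalar equations (`'` = `∂_x`, `Zp = Z(pf D³)`,
`Z'p = Z'(pf D³)`): `pf_τ = (w-1)pf' + pf(w' + 3w + 3 - 3r)`,
`w_τ = (w-1)w' + w² - rw + (2tf + tfpf'/pf + tf')Zp + tf Z'p pf' D³`,
`tf_τ = (w-1)tf' + (2/3) Zp tf w' + tf(2w - 2r + 2w Zp) + H (Zp - 1) tf`. -/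
def RadialReduction : Prop :=
  ∀ (r : ℝ) (D H Z : ℝ → ℝ) (pf w tf : ℝ × ℝ → ℝ) (z : ℝ × V3), z.2 ≠ 0 →
    DifferentiableAt ℝ pf (logPt z) → DifferentiableAt ℝ w (logPt z) → DifferentiableAt ℝ tf (logPt z) →
    0 < pf (logPt z) → DifferentiableAt ℝ Z (pf (logPt z) * D z.1 ^ 3) →
    (SelfSimEulerZAt r D H Z (radDensity pf) (radTemperature tf) (radVelocity w) z ↔
      (dτ pf (logPt z) = (w (logPt z) - 1) * dx pf (logPt z) +
          pf (logPt z) * (dx w (logPt z) + 3 * w (logPt z) + 3 - 3 * r) ∧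
       dτ w (logPt z) = (w (logPt z) - 1) * dx w (logPt z) + w (logPt z) ^ 2 - r * w (logPt z) +
          (2 * tf (logPt z) + tf (logPt z) * dx pf (logPt z) / pf (logPt z) + dx tf (logPt z)) *
              Z (pf (logPt z) * D z.1 ^ 3) +
            tf (logPt z) * deriv Z (pf (logPt z) * D z.1 ^ 3) * (dx pf (logPt z) * D z.1 ^ 3) ∧
       dτ tf (logPt z) = (w (logPt z) - 1) * dx tf (logPt z) +
          2 / 3 * Z (pf (logPt z) * D z.1 ^ 3) * tf (logPt z) * dx w (logPt z) +
          tf (logPt z) * (2 * w (logPt z) - 2 * r + 2 * w (logPt z) * Z (pf (logPt z) * D z.1 ^ 3)) +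
          H z.1 * (Z (pf (logPt z) * D z.1 ^ 3) - 1) * tf (logPt z)))

/-- Isentropic ideal radial density `𝒫 = C ‖ζ‖³ sf(τ, log‖ζ‖)³` (`ρ ∝ c³` for the monatomic gas). -/
def isenDensity (C : ℝ) (sf : ℝ × ℝ → ℝ) (z : ℝ × V3) : ℝ := C * ‖z.2‖ ^ 3 * sf (logPt z) ^ 3

/-- Isentropic ideal radial temperature `Θ̂ = (3/5) ‖ζ‖² sf²` (`ĉ = ‖ζ‖ sf` is the self-similar sound speed,
`ĉ² = (5/3) Θ̂`; profile: `sf = S`). -/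
def isenTemperature (sf : ℝ × ℝ → ℝ) (z : ℝ × V3) : ℝ := 3 / 5 * ‖z.2‖ ^ 2 * sf (logPt z) ^ 2

/-- Statement of `stub_isentropicReduction` (W2): off the centre, for `(w, sf)(τ, x)` differentiable at
`p = (τ, log‖ζ‖)` with `sf(p) > 0`, `C > 0`, the IDEAL (`Z ≡ 1`) self-similar system for the isentropic radial fields
is equivalent to the planner's two equations `w_τ = (w-1)w' + 3sfsf' + w² - rw + 3sf²`,
`sf_τ = (w-1)sf' + (sf/3)w' + sf(2w - r)` — whose steady states are the original-form profile equations of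
`stub_profileEqs` and whose linearisation is `(linW, linS)` (`stub_linearisation`). -/
def IsentropicReduction : Prop :=
  ∀ (r C : ℝ) (D H : ℝ → ℝ) (w sf : ℝ × ℝ → ℝ) (z : ℝ × V3), z.2 ≠ 0 → 0 < C →
    DifferentiableAt ℝ w (logPt z) → DifferentiableAt ℝ sf (logPt z) → 0 < sf (logPt z) →
    (SelfSimEulerZAt r D H (fun _ => 1) (isenDensity C sf) (isenTemperature sf) (radVelocity w) z ↔
      (dτ w (logPt z) = (w (logPt z) - 1) * dx w (logPt z) + 3 * sf (logPt z) * dx sf (logPt z) +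
          w (logPt z) ^ 2 - r * w (logPt z) + 3 * sf (logPt z) ^ 2 ∧
       dτ sf (logPt z) = (w (logPt z) - 1) * dx sf (logPt z) + sf (logPt z) / 3 * dx w (logPt z) +
          sf (logPt z) * (2 * w (logPt z) - r)))

/-- The r2 spectral vocabulary IS the linearisation of the isentropic self-similar system: the `ε`-derivatives at
`0` of the two right-hand sides of `IsentropicReduction` along a (complex) jet perturbation
`(W, S, W', S') + ε (ŵ, ŝ, ŵ', ŝ')` are `linW r W S ŵ ŝ x` and `linS r W S ŵ ŝ x`. [folklore] -/
theorem stub_linearisation : ∀ (r : ℝ) (W S : ℝ → ℝ) (ŵ ŝ : ℝ → ℂ) (x : ℝ),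
    HasDerivAt (fun ε : ℂ =>
        ((W x : ℂ) + ε * ŵ x - 1) * (((deriv W x : ℝ) : ℂ) + ε * deriv ŵ x) +
          3 * ((S x : ℂ) + ε * ŝ x) * (((deriv S x : ℝ) : ℂ) + ε * deriv ŝ x) +
          ((W x : ℂ) + ε * ŵ x) ^ 2 - r * ((W x : ℂ) + ε * ŵ x) + 3 * ((S x : ℂ) + ε * ŝ x) ^ 2)
      (linW r W S ŵ ŝ x) 0 ∧
    HasDerivAt (fun ε : ℂ =>
        ((W x : ℂ) + ε * ŵ x - 1) * (((deriv S x : ℝ) : ℂ) + ε * deriv ŝ x) +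
          ((S x : ℂ) + ε * ŝ x) / 3 * (((deriv W x : ℝ) : ℂ) + ε * deriv ŵ x) +
          ((S x : ℂ) + ε * ŝ x) * (2 * ((W x : ℂ) + ε * ŵ x) - r))
      (linS r W S ŵ ŝ x) 0 := by
  intro r W S ŵ ŝ x
  -- both right-hand sides are quadratic polynomials in `ε`; their linear coefficients are `linW`, `linS`.
  have hpoly : ∀ C0 A C2 : ℂ, HasDerivAt (fun ε : ℂ => C0 + A * ε + C2 * (ε * ε)) A 0 := by
    intro C0 A C2
    have h1 : HasDerivAt (fun ε : ℂ => C0 + A * ε) A 0 := by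
      simpa using ((hasDerivAt_id (0 : ℂ)).const_mul A).const_add C0
    have h2 : HasDerivAt (fun ε : ℂ => C2 * (ε * ε)) 0 0 := by
      simpa using ((hasDerivAt_id (0 : ℂ)).mul (hasDerivAt_id (0 : ℂ))).const_mul C2
    have h := h1.add h2
    rw [add_zero] at h
    refine h.congr_of_eventuallyEq (Filter.Eventually.of_forall fun ε => ?_)
    simp only [Pi.add_apply]
  constructor
  · have key := hpoly
      ((((W x : ℝ) : ℂ) - 1) * ((deriv W x : ℝ) : ℂ) + 3 * ((S x : ℝ) : ℂ) * ((deriv S x : ℝ) : ℂ) +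
        ((W x : ℝ) : ℂ) ^ 2 - (r : ℂ) * ((W x : ℝ) : ℂ) + 3 * ((S x : ℝ) : ℂ) ^ 2)
      (linW r W S ŵ ŝ x)
      (ŵ x * deriv ŵ x + 3 * ŝ x * deriv ŝ x + ŵ x ^ 2 + 3 * ŝ x ^ 2)
    convert key using 1
    funext ε
    simp only [linW]
    push_cast
    ring
  · have key := hpoly
      ((((W x : ℝ) : ℂ) - 1) * ((deriv S x : ℝ) : ℂ) + ((S x : ℝ) : ℂ) / 3 * ((deriv W x : ℝ) : ℂ) +
        ((S x : ℝ) : ℂ) * (2 * ((W x : ℝ) : ℂ) - (r : ℂ)))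
      (linS r W S ŵ ŝ x)
      (ŵ x * deriv ŝ x + ŝ x / 3 * deriv ŵ x + ŝ x * (2 * ŵ x))
    convert key using 1
    funext ε
    simp only [linS]
    push_cast
    ring


end Summit.AtomisticToContinuum.HydrodynamicLimit.Theorems.R2OneModeTwoConditions

end
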